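import Mathlib
import Summits.ResolutionOfSingularities.ResolutionOfSingularities.Theorems.HomologicalConductorPersistenceCyclicQuotientNumerationSeries
import HarnessLib

/-!
# Rung S-2 `PersistenceSurface` (stmt-ResolutionOfSingularities-19970), stub C1 (`Sat₄`) on the toric class —
# toward S4 (drops = greedy digits): LEMMA F2, the SUCCESSIVE MINIMA of `q·d mod n` are the `i`-series

Route `ResolutionOfSingularities/HomologicalConductor`, rung S-2 `PersistenceSurface` (stmt-19970), registered stub
`stub_saturationFourSurfaceResidualFour`, class (iii) «`Sat₄` at non-Gorenstein rational (toric) stages».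
[OURS · cell decomp-res · seat leafhand-res-homologicalconduct-13 gen 1; AI-written, weaker than expert review; NOT a
statement of the manuscript under review (Hironaka 2017), and no statement of that manuscript is used.]

For a Hirzebruch–Jung chain `(e, i, b)` with its `j`-series (part `…NumerationSeries`: `exists_jSeries`,
`det_identity`, `exists_kSeries`) — so `n = i 0`, `q = i 1`, `q · j_s ≡ i_s (mod n)` —

* **`le_mod_of_lt_jSeries` (LEMMA F2, successive minima).**  For `1 ≤ s ≤ e + 1` and `1 ≤ d < j s`:
  `i (s-1) ≤ (q · d) % n`.  PROOF (HAND13-NUMERATION §2): `(d, (q d) % n)` lies in the lattice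
  `L = {(x, y) : y ≡ q x (mod n)}` of which `(j_{s-1}, i_{s-1}), (j_s, i_s)` is a `ℤ`-basis (LEMMA D + F1); write
  `(d, g) = α (j_{s-1}, i_{s-1}) + β (j_s, i_s)` with `α = d k_s − m j_s`, `β = m j_{s-1} − d k_{s-1}`
  (`q d = g + n m`, `q j_s = i_s + n k_s`) and chase signs: `β ≥ 1` contradicts `d < j_s`, `β = 0` gives
  `g = α i_{s-1} ≥ i_{s-1}`, `β ≤ −1` forces `α ≥ 1 − β` and `g ≥ i_{s-1} + |β| (i_{s-1} − i_s)`.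
* `one_le_jSeries` — the `j`-series increases through `e + 1`; `jSeries_step` — F2 and F1 packaged for the greedy
  staircase (next part): for `1 ≤ s ≤ e`, `1 ≤ j s`, `(q · j s) % n = i s` (part 4's `mod_eq_of_kSeries`), and every
  `1 ≤ d < j s` has `i (s-1) ≤ (q d) % n`.

This is the arithmetic heart of «the drops of the record staircase of a weight class are the greedy digits along the
`i`-series» (S4); no crux, kill test or summit statement is proved here.

References: O. Riemenschneider, Math. Ann. 209 (1974) (`i`/`j`-series; language only); HAND13-NUMERATION §2 (OURS,
cell memo) for the statement and the proof being typed.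
-/

-- single-problem summit: the doubled namespace component `ResolutionOfSingularities` is forced
set_option linter.dupNamespace false

namespace Summit.ResolutionOfSingularities.ResolutionOfSingularities.Theorems.HomologicalConductor.PersistenceCyclicQuotientNumeration

/-- **LEMMA F2 (successive minima of `q·d mod n` are the `i`-series).**  For a Hirzebruch–Jung chain `(e, i, b)`
with `j`-series `j` (non-decreasing), `1 ≤ s ≤ e + 1` and `1 ≤ d < j s`: `i (s-1) ≤ (i 1 * d) % i 0`, i.e. no
multiple `q d` with `d < j_s` has residue below `i_{s-1}` (lattice-basis sign chase, HAND13-NUMERATION §2). [folklore] -/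
theorem le_mod_of_lt_jSeries {e : ℕ} {i b j : ℕ → ℕ} (hie : i e = 1) (hie1 : i (e + 1) = 0)
    (hrec : ∀ s, 1 ≤ s → s ≤ e → i (s - 1) + i (s + 1) = b s * i s) (hb : ∀ s, 1 ≤ s → s ≤ e → 2 ≤ b s)
    (hj0 : j 0 = 0) (hj1 : j 1 = 1) (hjrec : ∀ s, 1 ≤ s → s ≤ e → j (s - 1) + j (s + 1) = b s * j s)
    (hjmono : ∀ s, s ≤ e → j s ≤ j (s + 1))
    (s : ℕ) (hs1 : 1 ≤ s) (hse : s ≤ e + 1) (d : ℕ) (hd1 : 1 ≤ d) (hdj : d < j s) :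
    i (s - 1) ≤ (i 1 * d) % i 0 := by
  have h2 := two_mul_le_of_chain hrec hb
  have hlt : i s < i (s - 1) := by
    have := lt_of_chain hie hie1 h2 (s - 1) (by omega)
    rwa [show s - 1 + 1 = s by omega] at this
  have hn : 1 ≤ i 0 := one_le_of_chain hie hie1 h2 0 (Nat.zero_le _)
  have hjm : j (s - 1) ≤ j s := by
    have := hjmono (s - 1) (by omega)
    rwa [show s - 1 + 1 = s by omega] at this
  -- the certificates: F1 at `s` and `s - 1`, D at `s`, Euclid for `q d`
  obtain ⟨ks, hks⟩ := exists_kSeries hrec hb hj0 hj1 hjrec s hs1 hse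
  obtain ⟨ks1, hks1⟩ : ∃ ks1 : ℤ, (i (s - 1) : ℤ) + (i 0 : ℤ) * ks1 = (i 1 : ℤ) * (j (s - 1) : ℤ) := by
    rcases Nat.lt_or_ge 1 s with hs2 | hs2
    · obtain ⟨k', hk'⟩ := exists_kSeries hrec hb hj0 hj1 hjrec (s - 1) (by omega) (by omega)
      exact ⟨k', by exact_mod_cast hk'⟩
    · obtain rfl : s = 1 := le_antisymm hs2 hs1
      exact ⟨-1, by simp [hj0]⟩
  have hdet := det_identity hrec hj0 hj1 hjrec s hs1 hse
  have hdm : (i 1 * d) % i 0 + i 0 * (i 1 * d / i 0) = i 1 * d := Nat.mod_add_div _ _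
  set g := (i 1 * d) % i 0 with hg
  set m := i 1 * d / i 0 with hm
  -- pass to `ℤ`
  have E1 : (i (s - 1) : ℤ) * (j s : ℤ) = (i s : ℤ) * (j (s - 1) : ℤ) + (i 0 : ℤ) := by exact_mod_cast hdet
  have E2 : (i s : ℤ) + (i 0 : ℤ) * (ks : ℤ) = (i 1 : ℤ) * (j s : ℤ) := by exact_mod_cast hks
  have E3 := hks1
  have E4 : (g : ℤ) + (i 0 : ℤ) * (m : ℤ) = (i 1 : ℤ) * (d : ℤ) := by exact_mod_cast hdm
  have hn' : (i 0 : ℤ) ≠ 0 := by exact_mod_cast (show i 0 ≠ 0 by omega)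
  -- the unimodularity relations of the two certificates
  have hu1 : (ks : ℤ) * (j (s - 1) : ℤ) - ks1 * (j s : ℤ) = 1 := by
    have h : (i 0 : ℤ) * ((ks : ℤ) * (j (s - 1) : ℤ) - ks1 * (j s : ℤ)) = (i 0 : ℤ) * 1 := by
      linear_combination (j (s - 1) : ℤ) * E2 - (j s : ℤ) * E3 + E1
    exact mul_left_cancel₀ hn' h
  have hu2 : (ks : ℤ) * (i (s - 1) : ℤ) - ks1 * (i s : ℤ) = (i 1 : ℤ) := by
    have h : (i 0 : ℤ) * ((ks : ℤ) * (i (s - 1) : ℤ) - ks1 * (i s : ℤ)) = (i 0 : ℤ) * (i 1 : ℤ) := by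
      linear_combination (i (s - 1) : ℤ) * E2 - (i s : ℤ) * E3 + (i 1 : ℤ) * E1
    exact mul_left_cancel₀ hn' h
  -- the lattice coordinates of `(d, g)`
  set α : ℤ := (d : ℤ) * (ks : ℤ) - (m : ℤ) * (j s : ℤ) with hα
  set β : ℤ := (m : ℤ) * (j (s - 1) : ℤ) - (d : ℤ) * ks1 with hβ
  have hD : α * (j (s - 1) : ℤ) + β * (j s : ℤ) = (d : ℤ) := by
    rw [hα, hβ]; linear_combination (d : ℤ) * hu1
  have hG : α * (i (s - 1) : ℤ) + β * (i s : ℤ) = (g : ℤ) := by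
    rw [hα, hβ]; linear_combination (d : ℤ) * hu2 - (m : ℤ) * E1 - E4
  -- integer copies of the inequalities
  have hd1' : (1 : ℤ) ≤ (d : ℤ) := by exact_mod_cast hd1
  have hdj' : (d : ℤ) + 1 ≤ (j s : ℤ) := by exact_mod_cast hdj
  have hlt' : (i s : ℤ) < (i (s - 1) : ℤ) := by exact_mod_cast hlt
  have hjm' : (j (s - 1) : ℤ) ≤ (j s : ℤ) := by exact_mod_cast hjm
  have hIs : (0 : ℤ) ≤ (i s : ℤ) := by positivity
  have hJs1 : (0 : ℤ) ≤ (j (s - 1) : ℤ) := by positivity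
  have hg0 : (0 : ℤ) ≤ (g : ℤ) := by positivity
  suffices h : (i (s - 1) : ℤ) ≤ (g : ℤ) by exact_mod_cast h
  clear_value α β g m
  rcases lt_trichotomy β 0 with hβn | hβ0 | hβp
  · -- `β ≤ -1`: `α ≥ 1 - β`, then `g ≥ i (s-1) + |β| (i (s-1) - i s)`
    have hαβ : 1 - β ≤ α := by
      by_contra hcon
      have hα' : α ≤ -β := by omega
      have h1 : α * (j (s - 1) : ℤ) ≤ (-β) * (j (s - 1) : ℤ) := mul_le_mul_of_nonneg_right hα' hJs1
      have h2 : (-β) * (j (s - 1) : ℤ) ≤ (-β) * (j s : ℤ) := mul_le_mul_of_nonneg_left hjm' (by omega)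
      linarith
    have h3 : (1 - β) * (i (s - 1) : ℤ) ≤ α * (i (s - 1) : ℤ) := mul_le_mul_of_nonneg_right hαβ (by positivity)
    have h4 : (-β) * (i s : ℤ) ≤ (-β) * (i (s - 1) : ℤ) := mul_le_mul_of_nonneg_left hlt'.le (by omega)
    linarith
  · -- `β = 0`: `d = α j (s-1)` forces `α ≥ 1`, and `g = α i (s-1)`
    subst hβ0
    have hα1 : 1 ≤ α := by
      by_contra hcon
      have hα' : α ≤ 0 := by omega
      have h1 : α * (j (s - 1) : ℤ) ≤ 0 := mul_nonpos_of_nonpos_of_nonneg hα' hJs1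
      linarith
    have h3 : 1 * (i (s - 1) : ℤ) ≤ α * (i (s - 1) : ℤ) := mul_le_mul_of_nonneg_right hα1 (by positivity)
    linarith
  · -- `β ≥ 1`: impossible (`d < j s`)
    exfalso
    have hα : α ≤ -1 := by
      by_contra hcon
      have hα' : 0 ≤ α := by omega
      have h1 : 0 ≤ α * (j (s - 1) : ℤ) := mul_nonneg hα' hJs1
      have h2 : 1 * (j s : ℤ) ≤ β * (j s : ℤ) := mul_le_mul_of_nonneg_right (by omega) (by positivity)
      linarith
    have hβα : 1 - α ≤ β := by
      by_contra hcon
      have hβ' : β ≤ -α := by omega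
      have h1 : β * (i s : ℤ) ≤ (-α) * (i s : ℤ) := mul_le_mul_of_nonneg_right hβ' hIs
      have h2 : (-α) * (i s : ℤ) < (-α) * (i (s - 1) : ℤ) := mul_lt_mul_of_pos_left hlt' (by omega)
      linarith
    have h3 : (1 - α) * (j s : ℤ) ≤ β * (j s : ℤ) := mul_le_mul_of_nonneg_right hβα (by positivity)
    have h4 : (-α) * (j (s - 1) : ℤ) ≤ (-α) * (j s : ℤ) := mul_le_mul_of_nonneg_left hjm' (by omega)
    linarith

/-- **The `j`-series is increasing through `e + 1`** (so `1 ≤ j s` for `1 ≤ s ≤ e + 1`): from `j (s+1) = b s j s − j (s-1)`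
with `b s ≥ 2`. [folklore] -/
theorem one_le_jSeries {e : ℕ} {b j : ℕ → ℕ} (hb : ∀ s, 1 ≤ s → s ≤ e → 2 ≤ b s)
    (hj0 : j 0 = 0) (hj1 : j 1 = 1) (hjrec : ∀ s, 1 ≤ s → s ≤ e → j (s - 1) + j (s + 1) = b s * j s) :
    ∀ s, 1 ≤ s → s ≤ e + 1 → j (s - 1) < j s := by
  intro s hs1 hse
  induction s with
  | zero => omega
  | succ s ih =>
    rcases Nat.eq_zero_or_pos s with rfl | hs
    · rw [Nat.zero_add, Nat.sub_self, hj0, hj1]; exact Nat.zero_lt_one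
    · have h := ih hs (by omega)
      have hj := hjrec s hs (by omega)
      have h2 : 2 * j s ≤ b s * j s := Nat.mul_le_mul_right _ (hb s hs (by omega))
      rw [Nat.add_sub_cancel]
      omega

/-- **F2 and F1 packaged for the greedy staircase**: for `1 ≤ s ≤ e`, `1 ≤ j s`, `(i 1 * j s) % i 0 = i s`, and every
`d < j s` with `1 ≤ d` has `i (s-1) ≤ (i 1 * d) % i 0`. [folklore] -/
theorem jSeries_step {e : ℕ} {i b j : ℕ → ℕ} (hie : i e = 1) (hie1 : i (e + 1) = 0)
    (hrec : ∀ s, 1 ≤ s → s ≤ e → i (s - 1) + i (s + 1) = b s * i s) (hb : ∀ s, 1 ≤ s → s ≤ e → 2 ≤ b s)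
    (hj0 : j 0 = 0) (hj1 : j 1 = 1) (hjrec : ∀ s, 1 ≤ s → s ≤ e → j (s - 1) + j (s + 1) = b s * j s)
    (hjmono : ∀ s, s ≤ e → j s ≤ j (s + 1)) (s : ℕ) (hs1 : 1 ≤ s) (hse : s ≤ e) :
    1 ≤ j s ∧ (i 1 * j s) % i 0 = i s ∧ ∀ d, 1 ≤ d → d < j s → i (s - 1) ≤ (i 1 * d) % i 0 := by
  refine ⟨?_, mod_eq_of_kSeries hie hie1 hrec hb hj0 hj1 hjrec s hs1 hse, fun d hd1 hdj =>
    le_mod_of_lt_jSeries hie hie1 hrec hb hj0 hj1 hjrec hjmono s hs1 (by omega) d hd1 hdj⟩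
  have := one_le_jSeries hb hj0 hj1 hjrec s hs1 (by omega)
  omega

end Summit.ResolutionOfSingularities.ResolutionOfSingularities.Theorems.HomologicalConductor.PersistenceCyclicQuotientNumeration
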